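import Summits.Ventures.YMGap.Census.RectReflectionGeometry
import HarnessLib

/-!
# Venture YMGap, track (b) census — reflection geometry of a RECTANGULAR torus, part 2: the reflection `Θ` and the
# crossing-link substitution on gauge configurations, measure preservation, holonomy identities, coordinate dependence

HONEST FRAMING: venture file of the cell `pub-ymgap` (QuantumFields programme), track (b).  Verbatim port to the rectangular
torus `RectTorusSite Ls` (time axis `0`, `L₀ := Ls 0` even where parity matters) of the tree's cubic Osterwalder–Seiler machinery
`Literature.MathematicalPhysics.QuantumFieldTheory.WilsonRP` (`ConstructiveQFTWave0Proofs`, §§ Classification2 / Action / Crossing /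
Measure); compact group `G`, continuous matrix representation `ρ`.  No physics; finite product Haar measures only.  File 2 of 3 of
the rectangular sign rule (`RectReflectionGeometry` → this → `TwistCensusTopMomentRectRP`).

* `posLinks` / `crossLinks` (the finsets `P`, `C`), `isPosLink_of_isPosPlaquette`, `links_of_lower` / `links_of_upper`;
* `configReflect` (`Θ`: spatial links carried along, temporal links reversed and inverted), `measurePreserving_configReflect`;
  `linkTranslate Y` (`U_e ↦ U_e Y_e` / `Y_e U_e` on the lower / upper crossing links), `measurePreserving_linkTranslate`;
* `plaqRe ρ U p = Re tr ρ(U_p)` on the rectangular torus; `plaqRe_configReflect` (`Re tr ρ((ΘU)_p) = Re tr ρ(U_{ϑp})`);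
  `halfHolonomy` and **the crossing identity** `plaqRe_linkTranslate_of_isCrossPlaquette`
  (`Re tr ρ((translate Y U)_p) = Σ_{kl} Re(σ(ω_p(z))_{kl} conj σ(ω_p(ΘU))_{kl})`, `z = splice_C(U, Y)`, `σ` the unitarised `ρ`);
* `dependsOn_configReflect_apply` (hypothesis `hΘdep` of `LatticeRP.integral_splice_mul_conj_comp`).

References: K. Osterwalder, E. Seiler, Ann. Phys. 110 (1978) 440, §2 [cite: OsterwalderSeilerAnnPhys1978, §2]; E. Seiler,
LNP 159 (1982) Ch. 2 [folklore].
-/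

noncomputable section

namespace Summit.Ventures.YMGap.Census

open MeasureTheory Finset
open Literature.MathematicalPhysics.QuantumLattice
open Literature.MathematicalPhysics.QuantumFieldTheory

namespace RectRP

variable {d : ℕ} {Ls : Fin d → ℕ}

/-! ### Links of positive and crossing plaquettes; the finsets `P`, `C` -/

section Classification2

variable [NeZero d] [∀ i, NeZero (Ls i)] [Fact (1 < Ls 0)]

omit [∀ i, NeZero (Ls i)] [Fact (1 < Ls 0)] in
/-- The second direction of a plaquette is spatial. -/
theorem plaq_snd_ne_zero (p : RectPlaquette Ls) : p.2.1.2 ≠ 0 := by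
  intro h
  have := p.2.2
  rw [h] at this
  exact (Fin.not_lt_zero _ this).elim

omit [Fact (1 < Ls 0)] in
/-- The four links of a positive plaquette are positive. -/
theorem isPosLink_of_isPosPlaquette {p : RectPlaquette Ls} (hp : IsPosPlaquette p) :
    IsPosLink (p.1, p.2.1.1) ∧ IsPosLink (p.1 + Pi.single p.2.1.1 1, p.2.1.2) ∧
      IsPosLink (p.1 + Pi.single p.2.1.2 1, p.2.1.1) ∧ IsPosLink (p.1, p.2.1.2) := by
  obtain ⟨x, ⟨⟨i, j⟩, hij⟩⟩ := p
  have hj : j ≠ 0 := plaq_snd_ne_zero (x, ⟨(i, j), hij⟩)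
  have hlt := ZMod.val_lt (x 0)
  unfold IsPosPlaquette at hp
  simp only at hp hj ⊢
  simp only [isPosLink_iff (Ls := Ls), hj, ↓reduceIte]
  by_cases hi : i = 0
  · subst hi
    simp only [↓reduceIte] at hp ⊢
    rw [val_shift_self, val_shift_of_ne _ (Ne.symm hj)]
    split_ifs <;> omega
  · simp only [hi, ↓reduceIte] at hp ⊢
    rw [val_shift_of_ne _ (Ne.symm hi), val_shift_of_ne _ (Ne.symm hj)]
    omega

/-- The links of the half-plaquette `ω_p` of a lower crossing plaquette. -/
theorem links_of_lower {p : RectPlaquette Ls} (ht : (p.1 0).val = 0) :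
    IsLowerLink (p.1, (0 : Fin d)) ∧ IsPosLink (p.1 + Pi.single 0 1, p.2.1.2) ∧
      IsLowerLink (p.1 + Pi.single p.2.1.2 1, (0 : Fin d)) := by
  have hj := plaq_snd_ne_zero p
  have h1L : 1 < Ls 0 := Fact.out
  refine ⟨⟨rfl, ht⟩, ?_, ⟨rfl, ?_⟩⟩
  · rw [isPosLink_iff (Ls := Ls)]
    simp only [hj, ↓reduceIte]
    rw [val_shift_self]
    split_ifs <;> omega
  · show ((p.1 + Pi.single p.2.1.2 1 : RectTorusSite Ls) 0).val = 0
    rw [val_shift_of_ne _ (Ne.symm hj), ht]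

/-- The links of the half-plaquette `ω_p` of an upper crossing plaquette. -/
theorem links_of_upper (hL : Even (Ls 0)) {p : RectPlaquette Ls} (ht : (p.1 0).val = Ls 0 / 2) :
    IsUpperLink (p.1, (0 : Fin d)) ∧ IsPosLink (p.1, p.2.1.2) ∧
      IsUpperLink (p.1 + Pi.single p.2.1.2 1, (0 : Fin d)) := by
  have hj := plaq_snd_ne_zero p
  have h1L : 1 < Ls 0 := Fact.out
  have hE := Nat.even_iff.mp hL
  refine ⟨⟨rfl, ht⟩, ?_, ⟨rfl, ?_⟩⟩
  · rw [isPosLink_iff (Ls := Ls)]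
    simp only [hj, ↓reduceIte]
    omega
  · show ((p.1 + Pi.single p.2.1.2 1 : RectTorusSite Ls) 0).val = Ls 0 / 2
    rw [val_shift_of_ne _ (Ne.symm hj), ht]

omit [∀ i, NeZero (Ls i)] [Fact (1 < Ls 0)] in
/-- Lower crossing links are crossing. -/
theorem IsLowerLink.isCrossLink {e : RectEdge Ls} (h : IsLowerLink e) : IsCrossLink e :=
  ⟨h.1, Or.inl h.2⟩

omit [∀ i, NeZero (Ls i)] [Fact (1 < Ls 0)] in
/-- Upper crossing links are crossing. -/
theorem IsUpperLink.isCrossLink {e : RectEdge Ls} (h : IsUpperLink e) : IsCrossLink e :=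
  ⟨h.1, Or.inr h.2⟩

omit [∀ i, NeZero (Ls i)] in
/-- Lower crossing links are not upper crossing (`L₀/2 ≠ 0`). -/
theorem IsLowerLink.not_isUpperLink {e : RectEdge Ls} (h : IsLowerLink e) : ¬ IsUpperLink e := by
  intro h'
  have h1L : 1 < Ls 0 := Fact.out
  have := h.2
  rw [h'.2] at this
  omega

/-- The finset `P` of positive-time links. -/
def posLinks : Finset (RectEdge Ls) := Finset.univ.filter IsPosLink

/-- The finset `C` of crossing links. -/
def crossLinks : Finset (RectEdge Ls) := Finset.univ.filter IsCrossLink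

omit [Fact (1 < Ls 0)] in
/-- Membership in `P`. -/
@[simp] theorem mem_posLinks {e : RectEdge Ls} : e ∈ (posLinks : Finset (RectEdge Ls)) ↔ IsPosLink e := by
  simp [posLinks]

omit [Fact (1 < Ls 0)] in
/-- Membership in `C`. -/
@[simp] theorem mem_crossLinks {e : RectEdge Ls} : e ∈ (crossLinks : Finset (RectEdge Ls)) ↔ IsCrossLink e := by
  simp [crossLinks]

end Classification2

/-! ### The reflection `Θ` and the crossing-link substitution on gauge configurations -/

section Config

variable [NeZero d] {G : Type*} [Group G]

/-- **The reflection `Θ` on gauge configurations**: spatial links are carried along, and the temporal link `x → x + e₀` is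
mapped to the reversed temporal link `θ(x + e₀) → θx`, whence the inverse (the cubic `GaugeConfig.timeReflect`). -/
def configReflect (U : RectGaugeConfig Ls G) : RectGaugeConfig Ls G :=
  fun e => if e.2 = 0 then (U (linkReflect e))⁻¹ else U (linkReflect e)

/-- `Θ` link by link. -/
theorem configReflect_apply (U : RectGaugeConfig Ls G) (e : RectEdge Ls) :
    configReflect U e = if e.2 = 0 then (U (linkReflect e))⁻¹ else U (linkReflect e) := rfl

/-- The substitution splitting the crossing links: `U_e ↦ U_e Y_e` on the lower crossing links (`t = 0 → 1`) and
`U_e ↦ Y_e U_e` on the upper ones (`t = L₀/2 → L₀/2 + 1`). -/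
def linkTranslate (Y U : RectGaugeConfig Ls G) : RectGaugeConfig Ls G := fun e =>
  (if IsUpperLink e then Y e else 1) * U e * (if IsLowerLink e then Y e else 1)

variable [∀ i, NeZero (Ls i)] [Fact (1 < Ls 0)]

omit [∀ i, NeZero (Ls i)] in
/-- `linkTranslate` on a lower crossing link: `U_e ↦ U_e Y_e`. -/
theorem linkTranslate_apply_of_isLowerLink (Y U : RectGaugeConfig Ls G) {e : RectEdge Ls} (he : IsLowerLink e) :
    linkTranslate Y U e = U e * Y e := by
  simp only [linkTranslate, if_pos he, if_neg he.not_isUpperLink, one_mul]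

omit [∀ i, NeZero (Ls i)] in
/-- `linkTranslate` on an upper crossing link: `U_e ↦ Y_e U_e`. -/
theorem linkTranslate_apply_of_isUpperLink (Y U : RectGaugeConfig Ls G) {e : RectEdge Ls} (he : IsUpperLink e) :
    linkTranslate Y U e = Y e * U e := by
  have : ¬ IsLowerLink e := fun h => h.not_isUpperLink he
  simp only [linkTranslate, if_pos he, if_neg this, mul_one]

omit [∀ i, NeZero (Ls i)] [Fact (1 < Ls 0)] in
/-- `linkTranslate` does not change non-crossing links. -/
theorem linkTranslate_apply_of_not_isCrossLink (Y U : RectGaugeConfig Ls G) {e : RectEdge Ls} (he : ¬ IsCrossLink e) :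
    linkTranslate Y U e = U e := by
  have h1 : ¬ IsLowerLink e := fun h => he h.isCrossLink
  have h2 : ¬ IsUpperLink e := fun h => he h.isCrossLink
  simp only [linkTranslate, if_neg h1, if_neg h2, one_mul, mul_one]

omit [∀ i, NeZero (Ls i)] [Fact (1 < Ls 0)] in
/-- `linkTranslate` does not change spatial links. -/
theorem linkTranslate_apply_of_ne_zero (Y U : RectGaugeConfig Ls G) {e : RectEdge Ls} (he : e.2 ≠ 0) :
    linkTranslate Y U e = U e :=
  linkTranslate_apply_of_not_isCrossLink Y U fun h => he h.1

omit [Fact (1 < Ls 0)] [Group G] in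
/-- The spliced configuration `z = splice_C(U, Y)` equals `Y` on crossing links. -/
theorem splice_apply_of_isCrossLink (U Y : RectGaugeConfig Ls G) {e : RectEdge Ls} (he : IsCrossLink e) :
    LatticeRP.splice crossLinks (U, Y) e = Y e := by
  simp [LatticeRP.splice, he]

omit [Fact (1 < Ls 0)] [Group G] in
/-- The spliced configuration `z = splice_C(U, Y)` equals `U` off the crossing links. -/
theorem splice_apply_of_not_isCrossLink (U Y : RectGaugeConfig Ls G) {e : RectEdge Ls} (he : ¬ IsCrossLink e) :
    LatticeRP.splice crossLinks (U, Y) e = U e := by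
  simp [LatticeRP.splice, he]

omit [∀ i, NeZero (Ls i)] [Fact (1 < Ls 0)] in
/-- The half plaquette `ω_p(V)`: for a lower crossing plaquette (`t = 0`) the path `x → x + e₀ → x + e₀ + eⱼ → x + eⱼ`, for an
upper one (`t = L₀/2`) the path `x + e₀ → x → x + eⱼ → x + eⱼ + e₀`. -/
def halfHolonomy (p : RectPlaquette Ls) (V : RectGaugeConfig Ls G) : G :=
  if (p.1 0).val = 0 then V (p.1, 0) * V (p.1 + Pi.single 0 1, p.2.1.2) * (V (p.1 + Pi.single p.2.1.2 1, 0))⁻¹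
  else (V (p.1, 0))⁻¹ * V (p.1, p.2.1.2) * V (p.1 + Pi.single p.2.1.2 1, 0)

end Config

/-! ### Holonomy identities: the reflected configuration and the crossing plaquettes after the substitution -/

section Holonomy

variable [NeZero d] [∀ i, NeZero (Ls i)] [Fact (1 < Ls 0)]
variable {N : ℕ} {G : Type*} [Group G] [TopologicalSpace G] [IsTopologicalGroup G] [CompactSpace G]
variable (ρ : G →* Matrix (Fin N) (Fin N) ℂ)

omit [NeZero d] [∀ i, NeZero (Ls i)] [Fact (1 < Ls 0)] [TopologicalSpace G] [IsTopologicalGroup G] [CompactSpace G] in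
/-- `Re tr ρ(U_p)` on the rectangular torus. -/
def plaqRe (U : RectGaugeConfig Ls G) (p : RectPlaquette Ls) : ℝ :=
  ((ρ (rectPlaquetteHolonomy U p.1 p.2.1.1 p.2.1.2)).trace).re

omit [∀ i, NeZero (Ls i)] [Fact (1 < Ls 0)] in
/-- `Re tr ρ((ΘU)_p) = Re tr ρ(U_{ϑp})`: the reflected holonomy is the holonomy of the reflected plaquette (spatial plaquettes) or
a conjugate of its inverse (temporal plaquettes). -/
theorem plaqRe_configReflect (hρ : Continuous ρ) (U : RectGaugeConfig Ls G) (p : RectPlaquette Ls) :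
    plaqRe ρ (configReflect U) p = plaqRe ρ U (plaquetteReflect p) := by
  obtain ⟨x, ⟨⟨i, j⟩, hij⟩⟩ := p
  have hj : j ≠ 0 := plaq_snd_ne_zero (x, ⟨(i, j), hij⟩)
  unfold plaqRe plaquetteReflect rectPlaquetteHolonomy
  simp only [configReflect_apply, linkReflect, hj, ↓reduceIte]
  by_cases hi : i = 0
  · subst hi
    simp only [↓reduceIte]
    rw [siteReflect_shift_shift_zero _ hj, ← siteReflect_shift_shift x]
    set y := siteReflect (x + Pi.single 0 1)
    rw [show (U (y, 0))⁻¹ * U (y, j) * ((U (y + Pi.single j 1, 0))⁻¹)⁻¹ * (U (y + Pi.single 0 1, j))⁻¹ =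
        (U (y, 0))⁻¹ * (U (y, 0) * U (y + Pi.single 0 1, j) * (U (y + Pi.single j 1, 0))⁻¹ * (U (y, j))⁻¹)⁻¹ *
          ((U (y, 0))⁻¹)⁻¹ by group,
      Literature.RepresentationTheory.CompactGroups.CompactGroup.trace_conj_eq,
      Literature.RepresentationTheory.CompactGroups.CompactGroup.re_trace_map_inv ρ hρ]
  · simp only [hi, ↓reduceIte]
    rw [siteReflect_shift_of_ne _ hi, siteReflect_shift_of_ne _ hj]

/-- **The crossing identity.** For a crossing plaquette `p`,
`Re tr ρ((translate Y U)_p) = Σ_{k,l} Re (σ(ω_p(z))_{kl} conj σ(ω_p(ΘU))_{kl})`, `σ` the unitarised representation and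
`z = splice_C(U, Y)`. -/
theorem plaqRe_linkTranslate_of_isCrossPlaquette (hL : Even (Ls 0)) (hρ : Continuous ρ) (U Y : RectGaugeConfig Ls G)
    {p : RectPlaquette Ls} (hp : IsCrossPlaquette p) :
    plaqRe ρ (linkTranslate Y U) p = ∑ k, ∑ l,
      (Literature.RepresentationTheory.CompactGroups.CompactGroup.unitarize ρ hρ
          (halfHolonomy p (LatticeRP.splice crossLinks (U, Y))) k l *
        (starRingEnd ℂ) (Literature.RepresentationTheory.CompactGroups.CompactGroup.unitarize ρ hρ
          (halfHolonomy p (configReflect U)) k l)).re := by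
  obtain ⟨x, ⟨⟨i, j⟩, hij⟩⟩ := p
  obtain ⟨hi, ht⟩ := hp
  simp only at hi ht
  subst hi
  have hj : j ≠ 0 := plaq_snd_ne_zero (x, ⟨(0, j), hij⟩)
  have h1L : 1 < Ls 0 := Fact.out
  have h2 : x 0 + x 0 = 0 := two_mul_eq_zero_of_val hL ht
  have h2j : (x + Pi.single j 1 : RectTorusSite Ls) 0 + (x + Pi.single j 1 : RectTorusSite Ls) 0 = 0 := by
    rw [shift_apply_of_ne _ (Ne.symm hj)]; exact h2
  have hΘ1 : configReflect U (x, 0) = (U (x, 0))⁻¹ := by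
    rw [configReflect_apply]
    simp only [linkReflect, ↓reduceIte, siteReflect_shift_of_two_mul h2]
  have hΘ2 : configReflect U (x + Pi.single 0 1, j) = U (x, j) := by
    rw [configReflect_apply]
    simp only [linkReflect, hj, ↓reduceIte, siteReflect_shift_of_two_mul h2]
  have hΘ3 : configReflect U (x + Pi.single j 1, 0) = (U (x + Pi.single j 1, 0))⁻¹ := by
    rw [configReflect_apply]
    simp only [linkReflect, ↓reduceIte, siteReflect_shift_of_two_mul h2j]
  have hΘ4 : configReflect U (x, j) = U (x + Pi.single 0 1, j) := by
    rw [configReflect_apply]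
    simp only [linkReflect, hj, ↓reduceIte, siteReflect_of_two_mul h2]
  unfold plaqRe rectPlaquetteHolonomy halfHolonomy
  simp only
  rcases ht with ht | ht
  · obtain ⟨hc1, -, hc3⟩ := links_of_lower (p := (x, ⟨(0, j), hij⟩)) ht
    simp only at hc1 hc3
    rw [if_pos ht, if_pos ht, linkTranslate_apply_of_isLowerLink Y U hc1,
      linkTranslate_apply_of_ne_zero Y U (e := (x + Pi.single 0 1, j)) hj,
      linkTranslate_apply_of_isLowerLink Y U hc3, linkTranslate_apply_of_ne_zero Y U (e := (x, j)) hj,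
      splice_apply_of_isCrossLink U Y hc1.isCrossLink,
      splice_apply_of_not_isCrossLink U Y (e := (x + Pi.single 0 1, j)) (fun h => hj h.1),
      splice_apply_of_isCrossLink U Y hc3.isCrossLink, hΘ1, hΘ2, hΘ3]
    rw [show U (x, 0) * Y (x, 0) * U (x + Pi.single 0 1, j) * (U (x + Pi.single j 1, 0) * Y (x + Pi.single j 1, 0))⁻¹ *
          (U (x, j))⁻¹ = U (x, 0) * ((Y (x, 0) * U (x + Pi.single 0 1, j) * (Y (x + Pi.single j 1, 0))⁻¹) *
          ((U (x, 0))⁻¹ * U (x, j) * ((U (x + Pi.single j 1, 0))⁻¹)⁻¹)⁻¹) * (U (x, 0))⁻¹ by group,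
      Literature.RepresentationTheory.CompactGroups.CompactGroup.trace_conj_eq,
      Literature.RepresentationTheory.CompactGroups.CompactGroup.re_trace_mul_inv_eq_sum ρ hρ]
  · have ht0 : (x 0).val ≠ 0 := by omega
    obtain ⟨hc1, -, hc3⟩ := links_of_upper hL (p := (x, ⟨(0, j), hij⟩)) ht
    simp only at hc1 hc3
    rw [if_neg ht0, if_neg ht0, linkTranslate_apply_of_isUpperLink Y U hc1,
      linkTranslate_apply_of_ne_zero Y U (e := (x + Pi.single 0 1, j)) hj,
      linkTranslate_apply_of_isUpperLink Y U hc3, linkTranslate_apply_of_ne_zero Y U (e := (x, j)) hj,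
      splice_apply_of_isCrossLink U Y hc1.isCrossLink,
      splice_apply_of_not_isCrossLink U Y (e := (x, j)) (fun h => hj h.1),
      splice_apply_of_isCrossLink U Y hc3.isCrossLink, hΘ1, hΘ4, hΘ3]
    rw [show Y (x, 0) * U (x, 0) * U (x + Pi.single 0 1, j) * (Y (x + Pi.single j 1, 0) * U (x + Pi.single j 1, 0))⁻¹ *
          (U (x, j))⁻¹ = Y (x, 0) * ((((U (x, 0))⁻¹)⁻¹ * U (x + Pi.single 0 1, j) * (U (x + Pi.single j 1, 0))⁻¹) *
          ((Y (x, 0))⁻¹ * U (x, j) * Y (x + Pi.single j 1, 0))⁻¹) * (Y (x, 0))⁻¹ by group,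
      Literature.RepresentationTheory.CompactGroups.CompactGroup.trace_conj_eq,
      Literature.RepresentationTheory.CompactGroups.CompactGroup.re_trace_mul_inv_eq_sum ρ hρ]
    refine Finset.sum_congr rfl fun k _ => Finset.sum_congr rfl fun l _ => ?_
    simp only [Complex.mul_re, Complex.conj_re, Complex.conj_im]
    ring

end Holonomy

/-! ### Measure preservation, measurability, dependence -/

section Measure

variable [NeZero d] [∀ i, NeZero (Ls i)] [Fact (1 < Ls 0)]
variable {N : ℕ} {G : Type*} [Group G] [TopologicalSpace G] [IsTopologicalGroup G] [CompactSpace G]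
  [MeasurableSpace G] [BorelSpace G]
variable (ρ : G →* Matrix (Fin N) (Fin N) ℂ)

omit [∀ i, NeZero (Ls i)] [Fact (1 < Ls 0)] [CompactSpace G] in
/-- The reflection `Θ` on configurations is measurable. -/
theorem measurable_configReflect :
    Measurable (configReflect : RectGaugeConfig Ls G → RectGaugeConfig Ls G) := by
  refine measurable_pi_lambda _ fun e => ?_
  simp only [configReflect_apply]
  split_ifs
  · exact (measurable_pi_apply _).inv
  · exact measurable_pi_apply _

omit [Fact (1 < Ls 0)] in
/-- **`Θ` preserves the product Haar measure**: it relabels the links by an involution and inverts the temporal ones, and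
Haar measure on the compact group `G` is inversion invariant. -/
theorem measurePreserving_configReflect :
    MeasurePreserving (configReflect : RectGaugeConfig Ls G → RectGaugeConfig Ls G)
      (LatticeRP.piMeasure (haarProbability G)) (LatticeRP.piMeasure (haarProbability G)) := by
  have h1 : MeasurePreserving
      (MeasurableEquiv.arrowCongr' (linkReflectEquiv (Ls := Ls)) (MeasurableEquiv.refl G))
      (LatticeRP.piMeasure (haarProbability G)) (LatticeRP.piMeasure (haarProbability G)) :=
    measurePreserving_arrowCongr' (fun _ => haarProbability G) (fun _ => haarProbability G)
      linkReflectEquiv (MeasurableEquiv.refl G) fun _ => MeasurePreserving.id _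
  have h2 : MeasurePreserving
      (fun (V : RectGaugeConfig Ls G) (e : RectEdge Ls) => (if e.2 = 0 then (fun g : G => g⁻¹) else id) (V e))
      (LatticeRP.piMeasure (haarProbability G)) (LatticeRP.piMeasure (haarProbability G)) := by
    refine measurePreserving_pi _ _ fun e => ?_
    split_ifs
    · exact Measure.measurePreserving_inv _
    · exact MeasurePreserving.id _
  have heq : (configReflect : RectGaugeConfig Ls G → RectGaugeConfig Ls G) =
      (fun (V : RectGaugeConfig Ls G) (e : RectEdge Ls) => (if e.2 = 0 then (fun g : G => g⁻¹) else id) (V e)) ∘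
      (MeasurableEquiv.arrowCongr' (linkReflectEquiv (Ls := Ls)) (MeasurableEquiv.refl G)) := by
    funext U e
    have happ : (MeasurableEquiv.arrowCongr' (linkReflectEquiv (Ls := Ls)) (MeasurableEquiv.refl G)) U e =
        U (linkReflect e) := rfl
    simp only [Function.comp_apply, configReflect_apply, happ]
    split_ifs <;> rfl
  rw [heq]
  exact h2.comp h1

omit [Fact (1 < Ls 0)] in
/-- **`linkTranslate Y` preserves the product Haar measure** (left and right invariance of Haar measure on `G`). -/
theorem measurePreserving_linkTranslate (Y : RectGaugeConfig Ls G) :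
    MeasurePreserving (linkTranslate Y)
      (LatticeRP.piMeasure (haarProbability G)) (LatticeRP.piMeasure (haarProbability G)) := by
  show MeasurePreserving (fun (U : RectGaugeConfig Ls G) (e : RectEdge Ls) =>
    (fun g : G => (if IsUpperLink e then Y e else 1) * g * (if IsLowerLink e then Y e else 1)) (U e))
      (LatticeRP.piMeasure (haarProbability G)) (LatticeRP.piMeasure (haarProbability G))
  exact measurePreserving_pi _ _ fun e =>
    (measurePreserving_mul_right (haarProbability G) _).comp (measurePreserving_mul_left (haarProbability G) _)

omit [TopologicalSpace G] [IsTopologicalGroup G] [CompactSpace G] [MeasurableSpace G] [BorelSpace G] in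
/-- The `P ∪ C`-coordinates of the reflected configuration depend only on the coordinates off `P` (hypothesis `hΘdep` of the
abstract mechanism `LatticeRP.integral_splice_mul_conj_comp`). -/
theorem dependsOn_configReflect_apply (hL : Even (Ls 0)) (e : RectEdge Ls)
    (he : e ∈ (posLinks ∪ crossLinks : Finset (RectEdge Ls))) :
    DependsOn (fun U : RectGaugeConfig Ls G => configReflect U e) (((posLinksᶜ : Finset (RectEdge Ls)) : Set (RectEdge Ls))) := by
  intro U V hUV
  have hmem : linkReflect e ∈ ((posLinksᶜ : Finset (RectEdge Ls)) : Set (RectEdge Ls)) := by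
    rw [Finset.mem_coe, Finset.mem_compl, mem_posLinks]
    rw [Finset.mem_union, mem_posLinks, mem_crossLinks] at he
    exact not_isPosLink_linkReflect hL he
  simp only [configReflect_apply, hUV _ hmem]

end Measure

end RectRP

end Summit.Ventures.YMGap.Census

end
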